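/-
Copyright (c) 2026 the pub-hodgecm-mathlib formalisation cell (harness21).  Prover seat hodgecm-mathlib-LH4-p12 (g7), req620 Track A «(D-RAM) FOUR-FRAME» squad — STAGE-1b
directive draft v1 (heir dealer LH4-plan (g13) WORD #52; heir LEAD F0P3a-plan (g20) T19-35 «=») §3: FIRST HAND on `stub_law_sq`, step (S1) «THE TRANSPORT HEAD».  Helper lane
`--supports stmt-HodgeConjecture-24833`.  2026-09-04.
-/
import Summits.HodgeConjecture.HodgeConjecture.Theorems.F0P3cDyRamLevelSumSignClasses               -- ★ (LH4-p09 (g8)): `two_mul_sum_kappaChar_mul_levelsCount_eq_sum_signClasses` (labelled (2b)); brings ★ p858820 labelled Stage A, ★ p858764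
import Summits.HodgeConjecture.HodgeConjecture.Theorems.F0P3cDyRamKappaSignLawR2OfKappaSignModelSum  -- ★ p856997 (LH4-p10 (g3)): the UNIT transport head (template); brings ★ `eq_of_two_mul_eq_of_eq_two_mul`, `chiSum_eq_unitSign_mul_chiSum`, `normIndexTwo`, `normSign_eq_one_or`, ★ №1-R2
import Summits.HodgeConjecture.HodgeConjecture.Theorems.F0P3cDyRamLevelsZeroEqSqLevel               -- ★ p859029 (F0P3a-p01 (g35)): `latticeInLevel_zero_of_mapGL_eq`, `setOf_levels_zero_eq_setOf_sqLevel`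
import HarnessLib

/-!
# Crux `H413`, line LH4 «(D-RAM) FOUR-FRAME» road, STAGE 1b — THE κ-SIGN TRANSPORT HEAD FOR THE LEVEL CENSUSES: (NI2) + the Ω-aware eightfold LABELLED κ-model sum ⟹ the
# κ-signed four-frame census law of the levels piece `𝟙{(Γ−1)M ⊆ ϖ^a M ∧ (Γ−1)²M ⊆ ϖ^{c′} M}` and of the square-level piece (`a = 0`) — the labelled twin of ★ p856997

Cell `hodgecm-mathlib` (D-0151), FLOOR 0, crux item H413 = `stmt-HodgeConjecture-24833`, route of record `HCCMUnconditional`; squad F0∕P3c∕LH4 (req618∕req620).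
THEOREMS ONLY (no `def`, no instance, no notation, no `sorry`, default heartbeats); lane `--supports stmt-HodgeConjecture-24833 --as helper` (count-neutral).

WHAT IS PROVED — the LABELLED twin of ★ p856997 `kappaSignLawAtS2_of_normIndexTwo_of_kappaSignModelSum2_8` (★ U3 §K-R2, the unit piece's head), DEF-FREE (the STAGE-1b DEFS leaf №5
is not yet written; the conclusions are the LAW SLOTS `hLlo ∕ hLhi ∕ hL` of the ★ junctions `F0P3cDyRamTierZeroRowsTwoThreeOfLevels.pieceRowsWild_gselStar_two_of_fencedLaws_of_hsides`
∕ `…three_of_fencedLaw_of_hside` AT ONE DATUM, token for token, for an ARBITRARY amplitude letter `A : ℕ → ℕ → ℕ → ℕ → ℤ → ℚ` and arbitrary level schedules `la lb : ℕ → ℕ`):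
* §1 `two_mul_kappaSum_levels_eq_unitSign_mul_chiSum` — `2·Σ_b κ_i(b)·#lev_{a,c′}(Γ_b) = w_i · Σ_s χ⁰_i(s)·LC_{a,c′}(s)` over `ℚ` (★ LH4-p09 (g8) (2b) `two_mul_sum_kappaChar_mul_levelsCount_eq_sum_signClasses`
  + ★ `chiSum_eq_unitSign_mul_chiSum`), `w_i = (ω(−1), ω(−1), 1)_i`, `LC_{a,c′}(s) = #{M : type-t for diag(d_s), T·M = M, D·M ⊆ ϖ^a M, D²·M ⊆ ϖ^{c′} M}`, `T = diag(α, β, 1)`,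
  `D = diag(α−1, β−1, 0)`.
* §2 **`levelsKappaSignClause_of_normIndexTwo_of_labelledModelSum (shift Ω N₀ la lb A) (σ ϖ d t) (hNI) (hLKSS)`** — at one datum: (NI2) a `σ`-fixed unit `c` with the index-two
  dichotomy, and the LABELLED (KSS²) binder «for every such `c`, every anti-fixed `δ ≠ 0`, roots `a, b ∈ E¹` with `v(a−1), v(b−1) < v 2`, element datum `(a², b²; n)` at `N₀ d`,
  `T = diag(a², b², 1)`, `2k + d = Σn + 2`, slot `i`, `2B = n_i − d + 2 − 2·shift d t`:  `Σ_s χ⁰_i(s)·LC_{la d, lb d}(s) = 2·(Ω_i·w_i·S_i)·A(q, d, t, k, B)`»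
  ⟹ THE LAW SLOT AT THE DATUM: `IsRamifiedQuadraticDatum σ ϖ d t → ∀ f δ a b n Γ k i B (binders of ★ №1-R2 verbatim), Σ_b κ_i(b)·#lev_{la d, lb d}(Γ_b) = (Ω_i·S_i)·A(q, d, t, k, B)`
  (`S_i = baseSign σ i · normSign σ (fPartProd δ (a, b, 1) i)`); proof = ★ p856997's, the label riding along (`2X = w_i·Y`, `Y = 2·w_i·(Ω_i S_i)·A`, `w_i² = 1` ⇒ `X = (Ω_i S_i)·A`,
  ★ `eq_of_two_mul_eq_of_eq_two_mul`).  `dyadicFenced_levelsKappaSignClause_…` puts it behind `|2| < 1`, and `…_ofRecord` discharges (NI2) by ★ `normIndexTwo` — the EXACT shape of the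
  junction slots `hLlo` (`la = fun d => d % 2`, `lb = mstarOfRecord`) and `hLhi` (`la = fun d => d % 2 + 1`) for every `K` at once.
* §3 THE SQUARE-LEVEL PIECE (`stub_law_sq`'s currency): `two_mul_kappaSum_sq_eq_unitSign_mul_chiSum` and **`sqKappaSignClause_of_normIndexTwo_of_labelledModelSum`** ∕ `…_ofRecord` —
  the same with the square-level count `#{M : type-0, Γ_b·M = M, (Γ_b−1)²M ⊆ ϖ^{m} M}` on the frame side and `#{M : type-0 for diag(d_s), T·M = M, D²·M ⊆ ϖ^{m} M}` on the model side
  (level `a = 0` is free on a fixed lattice: ★ p859029 `setOf_levels_zero_eq_setOf_sqLevel` on the frame side, `setOf_model_levels_zero_eq_setOf_model_sq` here on the model side) — at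
  `lb := mstarOfRecord` this is the junction slot `hL` of `…three_of_fencedLaw_of_hside` for every `K`, i.e. `stub_law_sq` MODULO the labelled census (sq-KSS²), which is step (S2).

NOTHING IS CLAIMED ABOUT (KSS²)-labelled: it is a BINDER (the STAGE-1b census proper — LH4-p09 (g8)'s labelled Stage A ★ p858820 + labelled strata ★ `LabelledSplitStrata` ∕
`LabelledGluedStratumRead` ∕ `LabelledCoreHangingStratumRead` ∕ `LabelledStrataPermutation` + a box re-summation pay it; directive draft v1 §3).  HONEST LABEL.  Count-neutral helper:
states no law, pays no stub; tier-0 rows T₊∕T₋∕regular OPEN; `HC_CM` is proved only modulo the 7 printed citations (2 remaining named inputs: hLiu418 = `stmt-HodgeConjecture-24832`,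
h413 = `stmt-HodgeConjecture-24833`) until rung 0 closes.

## References
* [Rogawski1990] J. D. Rogawski, *Automorphic Representations of Unitary Groups in Three Variables*, Ann. of Math. Stud. 123 (1990), §3.6 pp. 28–29, §4.9 Prop. 4.9.1 (a) p. 55.
* [LanglandsShelstad1987] R. P. Langlands, D. Shelstad, *On the definition of transfer factors*, Math. Ann. 278 (1987), §1.3 (κ-signs of the classes in a stable class).
* [Kottwitz1986BaseChangeUnits] R. E. Kottwitz, *Base change for unit elements of Hecke algebras*, Compositio Math. 60 (1986), §1 pp. 240–241 (fixed-lattice counting).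
-/

set_option autoImplicit false

noncomputable section

namespace Summit.HodgeConjecture.HodgeConjecture.Cruxes.H413.F0P3cDyRamLevelsKappaSignLawOfLabelledModelSum

open Matrix
open Literature.NumberTheory.Automorphic Literature.NumberTheory.Automorphic.HermitianLattice Literature.NumberTheory.Automorphic.UnitaryGroup
open Literature.NumberTheory.Automorphic.UnitaryLatticeTree Literature.NumberTheory.Automorphic.UnitaryThreeFourFrame
open Summit.HodgeConjecture.HodgeConjecture.Cruxes.H413.F0P3cDyRamStableSumSignClasses
open Summit.HodgeConjecture.HodgeConjecture.Cruxes.H413.F0P3cDyRamKappaAbsLawOfKappaModelSum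
open Summit.HodgeConjecture.HodgeConjecture.Cruxes.H413.F0P3cDyRamKappaSignLawOfKappaModelSum
open Summit.HodgeConjecture.HodgeConjecture.Cruxes.H413.F0P3cDyRamNormIndexTwo
open Summit.HodgeConjecture.HodgeConjecture.Cruxes.H413.F0P3cDyRamFourFrameLawDefs
open Summit.HodgeConjecture.HodgeConjecture.Cruxes.H413.F0P3cDyRamFourFrameLawDefsR
open Summit.HodgeConjecture.HodgeConjecture.Cruxes.H413.F0P3cDyRamFourFrameLawDefsR2
open Summit.HodgeConjecture.HodgeConjecture.Cruxes.H413.F0P3cDyRamFourFramePieces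
open Summit.HodgeConjecture.HodgeConjecture.Cruxes.H413.F0P3cDyRamFourFrameCensusDefs
open Summit.HodgeConjecture.HodgeConjecture.Cruxes.H413.F0P3cDyRamLevelSumSignClasses
open Summit.HodgeConjecture.HodgeConjecture.Cruxes.H413.F0P3cDyRamLevelsZeroEqSqLevel
open scoped Valued WithZero Matrix MatrixGroups

/-! ## §1  The κ-weighted eightfold symmetrisation of the LEVELS census, unit-sign form -/

section Sign

variable {K : Type} [Field K] [Valued K ℤᵐ⁰] {σ : K →+* K} {ϖ : K}

/-- **`2·Σ_b κ_i(b)·#lev_{a,c′}(Γ_b) = w_i · Σ_s χ⁰_i(s)·LC_{a,c′}(s)`** over `ℚ`, `w_i = (ω(−1), ω(−1), 1)_i` — ★ (2b) `two_mul_sum_kappaChar_mul_levelsCount_eq_sum_signClasses`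
with the unit sign pulled out of the class characters (★ `chiSum_eq_unitSign_mul_chiSum`); the labelled twin of ★ `two_mul_kappaSum_eq_unitSign_mul_chiSum`.
[cite: Rogawski1990, §3.6 pp. 28–29; §4.9 Prop. 4.9.1 (a) p. 55] [cite: LanglandsShelstad1987, §1.3] -/
theorem two_mul_kappaSum_levels_eq_unitSign_mul_chiSum (hσ : ∀ x, σ (σ x) = x) (hvσ : ∀ a, Valued.v (σ a) = Valued.v a)
    (hϖ : Valued.v ϖ = WithZero.exp (-1 : ℤ)) (heven : ∀ x : K, σ x = x → x ≠ 0 → ∃ n : ℤ, Valued.v x = WithZero.exp (2 * n))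
    {c : K} (hσc : σ c = c) (hvc : Valued.v c = 1)
    (hdich : ∀ x : K, σ x = x → x ≠ 0 → (∃ z : K, z * σ z = x) ∨ ∃ z : K, z * σ z = c * x)
    {f : Fin 4 → Fin 3 → (Fin 3 → K)} (hf : IsFourFrameFamily σ f) (α β : K)
    (T : GL (Fin 3) K) (hT : (T : Matrix (Fin 3) (Fin 3) K) = Matrix.diagonal ![α, β, 1])
    (Γ : Fin 4 → GL (Fin 3) K) (hΓ : ∀ b, (Γ b : Matrix (Fin 3) (Fin 3) K) = frameElt σ f b α β) (t a c' : ℕ) (i : Fin 3) :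
    (2 : ℚ) * ((∑ b : Fin 4, kappaChar i b *
        ({M : Submodule 𝒪[K] (Fin 3 → K) | IsVertexLattice σ ϖ ((StdForm.antidiagonal 3).over K) t M ∧ mapGL (Γ b) M = M ∧
          (LatticeInLevel ϖ a ((Γ b : Matrix (Fin 3) (Fin 3) K) - 1) M ∧
            LatticeInLevel ϖ c' (((Γ b : Matrix (Fin 3) (Fin 3) K) - 1) * ((Γ b : Matrix (Fin 3) (Fin 3) K) - 1)) M)}.ncard : ℤ) : ℤ) : ℚ) =
      (((![normSign σ (-1 : K), normSign σ (-1 : K), 1] : Fin 3 → ℤ) i : ℤ) : ℚ) *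
        ((∑ s : Fin 3 → Bool,
          (![(if s 1 then -1 else 1) * (if s 2 then -1 else 1),
             (if s 0 then -1 else 1) * (if s 2 then -1 else 1),
             (if s 0 then -1 else 1) * (if s 1 then -1 else 1)] : Fin 3 → ℤ) i *
            ({M : Submodule 𝒪[K] (Fin 3 → K) |
              IsVertexLattice σ ϖ (Matrix.diagonal fun j => if s j then c else (1 : K)) t M ∧ mapGL T M = M ∧
                (LatticeInLevel ϖ a (Matrix.diagonal ![α - 1, β - 1, 0]) M ∧
                  LatticeInLevel ϖ c' (Matrix.diagonal ![(α - 1) * (α - 1), (β - 1) * (β - 1), 0]) M)}.ncard : ℤ) : ℤ) : ℚ) := by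
  have hbridge := two_mul_sum_kappaChar_mul_levelsCount_eq_sum_signClasses hσ hvσ hϖ heven hσc hvc hdich hf α β T hT Γ hΓ t a c' i
  rw [chiSum_eq_unitSign_mul_chiSum] at hbridge
  exact_mod_cast hbridge

omit [Valued K ℤᵐ⁰] in
/-- `diag(α, β, 1) − 1 = diag(α−1, β−1, 0)`. [cite: Kottwitz1986BaseChangeUnits, §1 pp. 240–241] -/
theorem diagonal_sub_one_eq (α β : K) :
    (Matrix.diagonal ![α, β, 1] : Matrix (Fin 3) (Fin 3) K) - 1 = Matrix.diagonal ![α - 1, β - 1, 0] := by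
  ext i j
  fin_cases i <;> fin_cases j <;> simp

/-- On the MODEL side the first-level-`0` token is free on a `T`-fixed lattice (`T = diag(α, β, 1)`, `D = T − 1`):
`{M : type-t for H, T·M = M, D·M ⊆ ϖ^0 M ∧ D²·M ⊆ ϖ^b M} = {M : type-t for H, T·M = M, D²·M ⊆ ϖ^b M}` (★ p859029 `latticeInLevel_zero_of_mapGL_eq`).
[cite: Kottwitz1986BaseChangeUnits, §1 pp. 240–241] -/
theorem setOf_model_levels_zero_eq_setOf_model_sq (H : Matrix (Fin 3) (Fin 3) K) (t b : ℕ) (α β : K)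
    (T : GL (Fin 3) K) (hT : (T : Matrix (Fin 3) (Fin 3) K) = Matrix.diagonal ![α, β, 1]) :
    {M : Submodule 𝒪[K] (Fin 3 → K) | IsVertexLattice σ ϖ H t M ∧ mapGL T M = M ∧
        (LatticeInLevel ϖ 0 (Matrix.diagonal ![α - 1, β - 1, 0]) M ∧
          LatticeInLevel ϖ b (Matrix.diagonal ![(α - 1) * (α - 1), (β - 1) * (β - 1), 0]) M)} =
      {M : Submodule 𝒪[K] (Fin 3 → K) | IsVertexLattice σ ϖ H t M ∧ mapGL T M = M ∧
        LatticeInLevel ϖ b (Matrix.diagonal ![(α - 1) * (α - 1), (β - 1) * (β - 1), 0]) M} := by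
  ext M
  simp only [Set.mem_setOf_eq]
  constructor
  · rintro ⟨hV, hfix, -, hb⟩
    exact ⟨hV, hfix, hb⟩
  · rintro ⟨hV, hfix, hb⟩
    refine ⟨hV, hfix, ?_, hb⟩
    rw [← diagonal_sub_one_eq, ← hT]
    exact latticeInLevel_zero_of_mapGL_eq ϖ T hfix

/-- **SQUARE-LEVEL FORM: `2·Σ_b κ_i(b)·#sq_b(Γ_b) = w_i · Σ_s χ⁰_i(s)·SC_b(s)`** — §1's identity at first level `0`, the free token dropped on both sides (frame side ★ p859029
`setOf_levels_zero_eq_setOf_sqLevel`, model side `setOf_model_levels_zero_eq_setOf_model_sq`), type `0`.  [cite: Rogawski1990, §4.9 Prop. 4.9.1 (a) p. 55] [cite: LanglandsShelstad1987, §1.3] -/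
theorem two_mul_kappaSum_sq_eq_unitSign_mul_chiSum (hσ : ∀ x, σ (σ x) = x) (hvσ : ∀ a, Valued.v (σ a) = Valued.v a)
    (hϖ : Valued.v ϖ = WithZero.exp (-1 : ℤ)) (heven : ∀ x : K, σ x = x → x ≠ 0 → ∃ n : ℤ, Valued.v x = WithZero.exp (2 * n))
    {c : K} (hσc : σ c = c) (hvc : Valued.v c = 1)
    (hdich : ∀ x : K, σ x = x → x ≠ 0 → (∃ z : K, z * σ z = x) ∨ ∃ z : K, z * σ z = c * x)
    {f : Fin 4 → Fin 3 → (Fin 3 → K)} (hf : IsFourFrameFamily σ f) (α β : K)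
    (T : GL (Fin 3) K) (hT : (T : Matrix (Fin 3) (Fin 3) K) = Matrix.diagonal ![α, β, 1])
    (Γ : Fin 4 → GL (Fin 3) K) (hΓ : ∀ b, (Γ b : Matrix (Fin 3) (Fin 3) K) = frameElt σ f b α β) (m : ℕ) (i : Fin 3) :
    (2 : ℚ) * ((∑ b : Fin 4, kappaChar i b *
        ({M : Submodule 𝒪[K] (Fin 3 → K) | IsVertexLattice σ ϖ ((StdForm.antidiagonal 3).over K) 0 M ∧ mapGL (Γ b) M = M ∧
          LatticeInLevel ϖ m (((Γ b : Matrix (Fin 3) (Fin 3) K) - 1) * ((Γ b : Matrix (Fin 3) (Fin 3) K) - 1)) M}.ncard : ℤ) : ℤ) : ℚ) =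
      (((![normSign σ (-1 : K), normSign σ (-1 : K), 1] : Fin 3 → ℤ) i : ℤ) : ℚ) *
        ((∑ s : Fin 3 → Bool,
          (![(if s 1 then -1 else 1) * (if s 2 then -1 else 1),
             (if s 0 then -1 else 1) * (if s 2 then -1 else 1),
             (if s 0 then -1 else 1) * (if s 1 then -1 else 1)] : Fin 3 → ℤ) i *
            ({M : Submodule 𝒪[K] (Fin 3 → K) |
              IsVertexLattice σ ϖ (Matrix.diagonal fun j => if s j then c else (1 : K)) 0 M ∧ mapGL T M = M ∧
                LatticeInLevel ϖ m (Matrix.diagonal ![(α - 1) * (α - 1), (β - 1) * (β - 1), 0]) M}.ncard : ℤ) : ℤ) : ℚ) := by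
  have h := two_mul_kappaSum_levels_eq_unitSign_mul_chiSum hσ hvσ hϖ heven hσc hvc hdich hf α β T hT Γ hΓ 0 0 m i
  simp only [setOf_levels_zero_eq_setOf_sqLevel, setOf_model_levels_zero_eq_setOf_model_sq _ 0 m α β T hT] at h
  exact h

end Sign

/-! ## §2  THE LEVELS κ-SIGN LAW SLOT AT A DATUM from (NI2) + the Ω-aware labelled (KSS²) — the labelled twin of ★ p856997 -/

section Levels

variable {K : Type} [Field K] [Valued K ℤᵐ⁰] [CompleteSpace K] [Fintype 𝓀[K]]

omit [CompleteSpace K] in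
/-- **THE κ-SIGNED FOUR-FRAME LAW OF THE LEVELS PIECE AT A DATUM, FROM (NI2) + THE Ω-AWARE EIGHTFOLD LABELLED κ-MODEL SUM** — for ANY schedules `shift`, `Ω`, `N₀`, level
schedules `la lb` and amplitude letter `A`: if (NI2) a `σ`-fixed unit `c` with the index-two dichotomy exists, and (LKSS²) for every such `c`, anti-fixed `δ ≠ 0`, roots `a, b ∈ E¹` below
`v 2`, element datum `(a², b²; n)` at `N₀ d`, `T = diag(a², b², 1)`, `2k + d = Σn + 2`, slot `i`, `2B = n_i − d + 2 − 2·shift d t`: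
`Σ_s χ⁰_i(s)·#{M : type-0 for diag(d_s), T·M = M, D·M ⊆ ϖ^{la d}M, D²·M ⊆ ϖ^{lb d}M} = 2·(Ω_i·w_i·S_i)·A(q, d, t, k, B)` — THEN the law slot holds at this datum:
`IsRamifiedQuadraticDatum σ ϖ d t → … → Σ_b κ_i(b)·#lev_{la d, lb d}(Γ_b) = (Ω_i·S_i)·A(q, d, t, k, B)` (binders of ★ №1-R2 `KappaSignLawAtS2` verbatim; the junction slots
`hLlo`∕`hLhi` of ★ `F0P3cDyRamTierZeroRowsTwoThreeOfLevels` at one `K`, unfenced).  ★ p856997's proof with the label riding along.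
[cite: Rogawski1990, §4.9 Prop. 4.9.1 (a) p. 55] [cite: LanglandsShelstad1987, §1.3] [cite: Kottwitz1986BaseChangeUnits, §1 pp. 240–241] -/
theorem levelsKappaSignClause_of_normIndexTwo_of_labelledModelSum (shift : ℕ → ℕ → ℤ) (Ω : OmegaSchedule) (N₀ la lb : ℕ → ℕ)
    (A : ℕ → ℕ → ℕ → ℕ → ℤ → ℚ) (σ : K →+* K) (ϖ : K) (d t : ℕ)
    (hNI : ∃ c : K, σ c = c ∧ Valued.v c = 1 ∧ ∀ x : K, σ x = x → x ≠ 0 → (∃ z : K, z * σ z = x) ∨ ∃ z : K, z * σ z = c * x)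
    (hLKSS : ∀ c : K, σ c = c → Valued.v c = 1 → (∀ x : K, σ x = x → x ≠ 0 → (∃ z : K, z * σ z = x) ∨ ∃ z : K, z * σ z = c * x) →
      ∀ (δ : K), σ δ = -δ → δ ≠ 0 →
      ∀ (a b : K), a * σ a = 1 → b * σ b = 1 → Valued.v (a - 1) < Valued.v (2 : K) → Valued.v (b - 1) < Valued.v (2 : K) →
      ∀ (n₁ n₂ n₃ : ℕ), IsElementDatum σ ϖ (N₀ d) (a * a) (b * b) n₁ n₂ n₃ →
      ∀ (T : GL (Fin 3) K), (T : Matrix (Fin 3) (Fin 3) K) = Matrix.diagonal ![a * a, b * b, 1] →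
      ∀ (k : ℕ), 2 * k + d = n₁ + n₂ + n₃ + 2 →
      ∀ (i : Fin 3) (B : ℤ), 2 * B = ((![n₁, n₂, n₃] : Fin 3 → ℕ) i : ℤ) - d + 2 - 2 * shift d t →
        ((∑ s : Fin 3 → Bool,
            (![(if s 1 then -1 else 1) * (if s 2 then -1 else 1),
               (if s 0 then -1 else 1) * (if s 2 then -1 else 1),
               (if s 0 then -1 else 1) * (if s 1 then -1 else 1)] : Fin 3 → ℤ) i *
              ({M : Submodule 𝒪[K] (Fin 3 → K) |
                IsVertexLattice σ ϖ (Matrix.diagonal fun j => if s j then c else (1 : K)) 0 M ∧ mapGL T M = M ∧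
                  (LatticeInLevel ϖ (la d) (Matrix.diagonal ![a * a - 1, b * b - 1, 0]) M ∧
                    LatticeInLevel ϖ (lb d) (Matrix.diagonal ![(a * a - 1) * (a * a - 1), (b * b - 1) * (b * b - 1), 0]) M)}.ncard : ℤ) : ℤ) : ℚ) =
          2 * ((Ω K σ ϖ d a b i * ((![normSign σ (-1 : K), normSign σ (-1 : K), 1] : Fin 3 → ℤ) i *
            (baseSign σ i * normSign σ (fPartProd δ ![a, b, 1] i))) : ℤ) : ℚ) * A (Fintype.card 𝓀[K]) d t k B) :
    IsRamifiedQuadraticDatum σ ϖ d t →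
      ∀ (f : Fin 4 → Fin 3 → (Fin 3 → K)), IsFourFrameFamily σ f →
      ∀ (δ : K), σ δ = -δ → δ ≠ 0 →
      ∀ (a b : K), a * σ a = 1 → b * σ b = 1 → Valued.v (a - 1) < Valued.v (2 : K) → Valued.v (b - 1) < Valued.v (2 : K) →
      ∀ (n₁ n₂ n₃ : ℕ), IsElementDatum σ ϖ (N₀ d) (a * a) (b * b) n₁ n₂ n₃ →
      ∀ (Γ : Fin 4 → GL (Fin 3) K), (∀ b', (Γ b' : Matrix (Fin 3) (Fin 3) K) = frameElt σ f b' (a * a) (b * b)) →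
      ∀ (k : ℕ), 2 * k + d = n₁ + n₂ + n₃ + 2 →
      ∀ (i : Fin 3) (B : ℤ), 2 * B = ((![n₁, n₂, n₃] : Fin 3 → ℕ) i : ℤ) - d + 2 - 2 * shift d t →
        ((∑ b' : Fin 4, kappaChar i b' * ({M : Submodule (Valued.integer K) (Fin 3 → K) | IsVertexLattice σ ϖ ((StdForm.antidiagonal 3).over K) 0 M ∧ mapGL (Γ b') M = M ∧
            (LatticeInLevel ϖ (la d) ((Γ b' : Matrix (Fin 3) (Fin 3) K) - 1) M ∧
              LatticeInLevel ϖ (lb d) (((Γ b' : Matrix (Fin 3) (Fin 3) K) - 1) * ((Γ b' : Matrix (Fin 3) (Fin 3) K) - 1)) M)}.ncard : ℤ) : ℤ) : ℚ) =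
          (Ω K σ ϖ d a b i * (baseSign σ i * normSign σ (fPartProd δ ![a, b, 1] i)) : ℤ) * A (Fintype.card 𝓀[K]) d t k B := by
  intro hD f hf δ hσδ hδ0 a b ha hb ha1 hb1 n₁ n₂ n₃ hE Γ hΓ k hk i B hB
  obtain ⟨hσ, hvσ, hϖ, heven, -, -, -⟩ := hD
  obtain ⟨c, hσc, hvc, hdich⟩ := hNI
  have ha0 : a ≠ 0 := fun h => by rw [h, zero_mul] at ha; exact zero_ne_one ha
  have hb0 : b ≠ 0 := fun h => by rw [h, zero_mul] at hb; exact zero_ne_one hb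
  obtain ⟨α, hα⟩ : ∃ α : K, α = a * a := ⟨_, rfl⟩
  obtain ⟨β, hβ⟩ : ∃ β : K, β = b * b := ⟨_, rfl⟩
  have hα0 : α ≠ 0 := hα ▸ mul_ne_zero ha0 ha0
  have hβ0 : β ≠ 0 := hβ ▸ mul_ne_zero hb0 hb0
  let T : GL (Fin 3) K :=
    ⟨Matrix.diagonal ![α, β, 1], Matrix.diagonal ![α⁻¹, β⁻¹, 1],
      by rw [Matrix.diagonal_mul_diagonal, ← Matrix.diagonal_one]; congr 1; funext j; fin_cases j <;> simp [hα0, hβ0],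
      by rw [Matrix.diagonal_mul_diagonal, ← Matrix.diagonal_one]; congr 1; funext j; fin_cases j <;> simp [hα0, hβ0]⟩
  have hT : (T : Matrix (Fin 3) (Fin 3) K) = Matrix.diagonal ![a * a, b * b, 1] := by rw [← hα, ← hβ]
  have hK := hLKSS c hσc hvc hdich δ hσδ hδ0 a b ha hb ha1 hb1 n₁ n₂ n₃ hE T hT k hk i B hB
  have h0 := two_mul_kappaSum_levels_eq_unitSign_mul_chiSum hσ hvσ hϖ heven hσc hvc hdich hf (a * a) (b * b) T hT Γ hΓ 0 (la d) (lb d) i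
  have hw : (((![normSign σ (-1 : K), normSign σ (-1 : K), 1] : Fin 3 → ℤ) i : ℤ) : ℚ) = 1 ∨
      (((![normSign σ (-1 : K), normSign σ (-1 : K), 1] : Fin 3 → ℤ) i : ℤ) : ℚ) = -1 := by
    rcases normSign_eq_one_or σ (-1 : K) with h | h <;> rw [h] <;> fin_cases i <;> simp
  refine eq_of_two_mul_eq_of_eq_two_mul hw h0 ?_
  rw [hK]; push_cast; ring

/-- **THE FENCED LAW SLOT FOR EVERY `K` — the junction letter shape** (`|2| < 1 → IsRamifiedQuadraticDatum … → …`), with (NI2) DISCHARGED by ★ `normIndexTwo` at each datum: for ANY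
`shift Ω N₀ la lb A`, the labelled (LKSS²) binder (quantified over every complete datum with finite residue field) yields the `hLlo`∕`hLhi`-shaped slot of ★
`F0P3cDyRamTierZeroRowsTwoThreeOfLevels.pieceRowsWild_gselStar_two_of_fencedLaws_of_hsides` at the chosen `(la, lb)`.  Nothing is claimed about (LKSS²).
[cite: Rogawski1990, §4.9 Prop. 4.9.1 (a) p. 55] [cite: LanglandsShelstad1987, §1.3] -/
theorem fencedLevelsKappaSignSlot_of_labelledModelSum (shift : ℕ → ℕ → ℤ) (Ω : OmegaSchedule) (N₀ la lb : ℕ → ℕ) (A : ℕ → ℕ → ℕ → ℕ → ℤ → ℚ)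
    (hLKSS : ∀ {K : Type} [Field K] [Valued K ℤᵐ⁰] [CompleteSpace K] [Fintype 𝓀[K]] (σ : K →+* K) (ϖ : K) (d t : ℕ),
      Valued.v (2 : K) < 1 → IsRamifiedQuadraticDatum σ ϖ d t →
      ∀ c : K, σ c = c → Valued.v c = 1 → (∀ x : K, σ x = x → x ≠ 0 → (∃ z : K, z * σ z = x) ∨ ∃ z : K, z * σ z = c * x) →
      ∀ (δ : K), σ δ = -δ → δ ≠ 0 →
      ∀ (a b : K), a * σ a = 1 → b * σ b = 1 → Valued.v (a - 1) < Valued.v (2 : K) → Valued.v (b - 1) < Valued.v (2 : K) →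
      ∀ (n₁ n₂ n₃ : ℕ), IsElementDatum σ ϖ (N₀ d) (a * a) (b * b) n₁ n₂ n₃ →
      ∀ (T : GL (Fin 3) K), (T : Matrix (Fin 3) (Fin 3) K) = Matrix.diagonal ![a * a, b * b, 1] →
      ∀ (k : ℕ), 2 * k + d = n₁ + n₂ + n₃ + 2 →
      ∀ (i : Fin 3) (B : ℤ), 2 * B = ((![n₁, n₂, n₃] : Fin 3 → ℕ) i : ℤ) - d + 2 - 2 * shift d t →
        ((∑ s : Fin 3 → Bool,
            (![(if s 1 then -1 else 1) * (if s 2 then -1 else 1),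
               (if s 0 then -1 else 1) * (if s 2 then -1 else 1),
               (if s 0 then -1 else 1) * (if s 1 then -1 else 1)] : Fin 3 → ℤ) i *
              ({M : Submodule 𝒪[K] (Fin 3 → K) |
                IsVertexLattice σ ϖ (Matrix.diagonal fun j => if s j then c else (1 : K)) 0 M ∧ mapGL T M = M ∧
                  (LatticeInLevel ϖ (la d) (Matrix.diagonal ![a * a - 1, b * b - 1, 0]) M ∧
                    LatticeInLevel ϖ (lb d) (Matrix.diagonal ![(a * a - 1) * (a * a - 1), (b * b - 1) * (b * b - 1), 0]) M)}.ncard : ℤ) : ℤ) : ℚ) =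
          2 * ((Ω K σ ϖ d a b i * ((![normSign σ (-1 : K), normSign σ (-1 : K), 1] : Fin 3 → ℤ) i *
            (baseSign σ i * normSign σ (fPartProd δ ![a, b, 1] i))) : ℤ) : ℚ) * A (Fintype.card 𝓀[K]) d t k B)
    {K : Type} [Field K] [Valued K ℤᵐ⁰] [CompleteSpace K] [Fintype 𝓀[K]] (σ : K →+* K) (ϖ : K) (d t : ℕ) :
    Valued.v (2 : K) < 1 → IsRamifiedQuadraticDatum σ ϖ d t →
      ∀ (f : Fin 4 → Fin 3 → (Fin 3 → K)), IsFourFrameFamily σ f →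
      ∀ (δ : K), σ δ = -δ → δ ≠ 0 →
      ∀ (a b : K), a * σ a = 1 → b * σ b = 1 → Valued.v (a - 1) < Valued.v (2 : K) → Valued.v (b - 1) < Valued.v (2 : K) →
      ∀ (n₁ n₂ n₃ : ℕ), IsElementDatum σ ϖ (N₀ d) (a * a) (b * b) n₁ n₂ n₃ →
      ∀ (Γ : Fin 4 → GL (Fin 3) K), (∀ b', (Γ b' : Matrix (Fin 3) (Fin 3) K) = frameElt σ f b' (a * a) (b * b)) →
      ∀ (k : ℕ), 2 * k + d = n₁ + n₂ + n₃ + 2 →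
      ∀ (i : Fin 3) (B : ℤ), 2 * B = ((![n₁, n₂, n₃] : Fin 3 → ℕ) i : ℤ) - d + 2 - 2 * shift d t →
        ((∑ b' : Fin 4, kappaChar i b' * ({M : Submodule (Valued.integer K) (Fin 3 → K) | IsVertexLattice σ ϖ ((StdForm.antidiagonal 3).over K) 0 M ∧ mapGL (Γ b') M = M ∧
            (LatticeInLevel ϖ (la d) ((Γ b' : Matrix (Fin 3) (Fin 3) K) - 1) M ∧
              LatticeInLevel ϖ (lb d) (((Γ b' : Matrix (Fin 3) (Fin 3) K) - 1) * ((Γ b' : Matrix (Fin 3) (Fin 3) K) - 1)) M)}.ncard : ℤ) : ℤ) : ℚ) =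
          (Ω K σ ϖ d a b i * (baseSign σ i * normSign σ (fPartProd δ ![a, b, 1] i)) : ℤ) * A (Fintype.card 𝓀[K]) d t k B := by
  intro h2 hD
  exact levelsKappaSignClause_of_normIndexTwo_of_labelledModelSum shift Ω N₀ la lb A σ ϖ d t (normIndexTwo σ ϖ d t hD)
    (fun c hσc hvc hdich => hLKSS σ ϖ d t h2 hD c hσc hvc hdich) hD

end Levels

/-! ## §3  THE SQUARE-LEVEL LAW SLOT (`stub_law_sq`'s currency) from (NI2) + the labelled (sq-KSS²) -/

section Square

variable {K : Type} [Field K] [Valued K ℤᵐ⁰] [CompleteSpace K] [Fintype 𝓀[K]]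

omit [CompleteSpace K] in
/-- **THE κ-SIGNED FOUR-FRAME LAW OF THE SQUARE-LEVEL PIECE AT A DATUM, FROM (NI2) + THE Ω-AWARE EIGHTFOLD LABELLED κ-MODEL SUM (sq-KSS²)** — ANY `shift Ω N₀`, square-level
schedule `lb`, amplitude letter `A`: (sq-KSS²) «`Σ_s χ⁰_i(s)·#{M : type-0 for diag(d_s), T·M = M, D²·M ⊆ ϖ^{lb d}M} = 2·(Ω_i·w_i·S_i)·A(q, d, t, k, B)`» ⟹
`Σ_b κ_i(b)·#{M : type-0, Γ_b·M = M, (Γ_b−1)²M ⊆ ϖ^{lb d}M} = (Ω_i·S_i)·A(q, d, t, k, B)` — at `lb := mstarOfRecord`, `A := fun q d _ k B => ampl q (k − csOfRecord d) (B − csOfRecord d)`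
this is the (L-sq) signature sheet's target (T2) `SqKappaSignLawAtS2` at the datum (LH4-p12 (g7) `SIG-L-sq.v1` 93c44a1a), i.e. `stub_law_sq` modulo (sq-KSS²).
[cite: Rogawski1990, §4.9 Prop. 4.9.1 (a) p. 55] [cite: LanglandsShelstad1987, §1.3] [cite: Kottwitz1986BaseChangeUnits, §1 pp. 240–241] -/
theorem sqKappaSignClause_of_normIndexTwo_of_labelledModelSum (shift : ℕ → ℕ → ℤ) (Ω : OmegaSchedule) (N₀ lb : ℕ → ℕ)
    (A : ℕ → ℕ → ℕ → ℕ → ℤ → ℚ) (σ : K →+* K) (ϖ : K) (d t : ℕ)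
    (hNI : ∃ c : K, σ c = c ∧ Valued.v c = 1 ∧ ∀ x : K, σ x = x → x ≠ 0 → (∃ z : K, z * σ z = x) ∨ ∃ z : K, z * σ z = c * x)
    (hSKSS : ∀ c : K, σ c = c → Valued.v c = 1 → (∀ x : K, σ x = x → x ≠ 0 → (∃ z : K, z * σ z = x) ∨ ∃ z : K, z * σ z = c * x) →
      ∀ (δ : K), σ δ = -δ → δ ≠ 0 →
      ∀ (a b : K), a * σ a = 1 → b * σ b = 1 → Valued.v (a - 1) < Valued.v (2 : K) → Valued.v (b - 1) < Valued.v (2 : K) →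
      ∀ (n₁ n₂ n₃ : ℕ), IsElementDatum σ ϖ (N₀ d) (a * a) (b * b) n₁ n₂ n₃ →
      ∀ (T : GL (Fin 3) K), (T : Matrix (Fin 3) (Fin 3) K) = Matrix.diagonal ![a * a, b * b, 1] →
      ∀ (k : ℕ), 2 * k + d = n₁ + n₂ + n₃ + 2 →
      ∀ (i : Fin 3) (B : ℤ), 2 * B = ((![n₁, n₂, n₃] : Fin 3 → ℕ) i : ℤ) - d + 2 - 2 * shift d t →
        ((∑ s : Fin 3 → Bool,
            (![(if s 1 then -1 else 1) * (if s 2 then -1 else 1),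
               (if s 0 then -1 else 1) * (if s 2 then -1 else 1),
               (if s 0 then -1 else 1) * (if s 1 then -1 else 1)] : Fin 3 → ℤ) i *
              ({M : Submodule 𝒪[K] (Fin 3 → K) |
                IsVertexLattice σ ϖ (Matrix.diagonal fun j => if s j then c else (1 : K)) 0 M ∧ mapGL T M = M ∧
                  LatticeInLevel ϖ (lb d) (Matrix.diagonal ![(a * a - 1) * (a * a - 1), (b * b - 1) * (b * b - 1), 0]) M}.ncard : ℤ) : ℤ) : ℚ) =
          2 * ((Ω K σ ϖ d a b i * ((![normSign σ (-1 : K), normSign σ (-1 : K), 1] : Fin 3 → ℤ) i *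
            (baseSign σ i * normSign σ (fPartProd δ ![a, b, 1] i))) : ℤ) : ℚ) * A (Fintype.card 𝓀[K]) d t k B) :
    IsRamifiedQuadraticDatum σ ϖ d t →
      ∀ (f : Fin 4 → Fin 3 → (Fin 3 → K)), IsFourFrameFamily σ f →
      ∀ (δ : K), σ δ = -δ → δ ≠ 0 →
      ∀ (a b : K), a * σ a = 1 → b * σ b = 1 → Valued.v (a - 1) < Valued.v (2 : K) → Valued.v (b - 1) < Valued.v (2 : K) →
      ∀ (n₁ n₂ n₃ : ℕ), IsElementDatum σ ϖ (N₀ d) (a * a) (b * b) n₁ n₂ n₃ →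
      ∀ (Γ : Fin 4 → GL (Fin 3) K), (∀ b', (Γ b' : Matrix (Fin 3) (Fin 3) K) = frameElt σ f b' (a * a) (b * b)) →
      ∀ (k : ℕ), 2 * k + d = n₁ + n₂ + n₃ + 2 →
      ∀ (i : Fin 3) (B : ℤ), 2 * B = ((![n₁, n₂, n₃] : Fin 3 → ℕ) i : ℤ) - d + 2 - 2 * shift d t →
        ((∑ b' : Fin 4, kappaChar i b' * ({M : Submodule (Valued.integer K) (Fin 3 → K) | IsVertexLattice σ ϖ ((StdForm.antidiagonal 3).over K) 0 M ∧ mapGL (Γ b') M = M ∧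
            LatticeInLevel ϖ (lb d) (((Γ b' : Matrix (Fin 3) (Fin 3) K) - 1) * ((Γ b' : Matrix (Fin 3) (Fin 3) K) - 1)) M}.ncard : ℤ) : ℤ) : ℚ) =
          (Ω K σ ϖ d a b i * (baseSign σ i * normSign σ (fPartProd δ ![a, b, 1] i)) : ℤ) * A (Fintype.card 𝓀[K]) d t k B := by
  intro hD f hf δ hσδ hδ0 a b ha hb ha1 hb1 n₁ n₂ n₃ hE Γ hΓ k hk i B hB
  obtain ⟨hσ, hvσ, hϖ, heven, -, -, -⟩ := hD
  obtain ⟨c, hσc, hvc, hdich⟩ := hNI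
  have ha0 : a ≠ 0 := fun h => by rw [h, zero_mul] at ha; exact zero_ne_one ha
  have hb0 : b ≠ 0 := fun h => by rw [h, zero_mul] at hb; exact zero_ne_one hb
  obtain ⟨α, hα⟩ : ∃ α : K, α = a * a := ⟨_, rfl⟩
  obtain ⟨β, hβ⟩ : ∃ β : K, β = b * b := ⟨_, rfl⟩
  have hα0 : α ≠ 0 := hα ▸ mul_ne_zero ha0 ha0
  have hβ0 : β ≠ 0 := hβ ▸ mul_ne_zero hb0 hb0
  let T : GL (Fin 3) K :=
    ⟨Matrix.diagonal ![α, β, 1], Matrix.diagonal ![α⁻¹, β⁻¹, 1],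
      by rw [Matrix.diagonal_mul_diagonal, ← Matrix.diagonal_one]; congr 1; funext j; fin_cases j <;> simp [hα0, hβ0],
      by rw [Matrix.diagonal_mul_diagonal, ← Matrix.diagonal_one]; congr 1; funext j; fin_cases j <;> simp [hα0, hβ0]⟩
  have hT : (T : Matrix (Fin 3) (Fin 3) K) = Matrix.diagonal ![a * a, b * b, 1] := by rw [← hα, ← hβ]
  have hK := hSKSS c hσc hvc hdich δ hσδ hδ0 a b ha hb ha1 hb1 n₁ n₂ n₃ hE T hT k hk i B hB
  have h0 := two_mul_kappaSum_sq_eq_unitSign_mul_chiSum hσ hvσ hϖ heven hσc hvc hdich hf (a * a) (b * b) T hT Γ hΓ (lb d) i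
  have hw : (((![normSign σ (-1 : K), normSign σ (-1 : K), 1] : Fin 3 → ℤ) i : ℤ) : ℚ) = 1 ∨
      (((![normSign σ (-1 : K), normSign σ (-1 : K), 1] : Fin 3 → ℤ) i : ℤ) : ℚ) = -1 := by
    rcases normSign_eq_one_or σ (-1 : K) with h | h <;> rw [h] <;> fin_cases i <;> simp
  refine eq_of_two_mul_eq_of_eq_two_mul hw h0 ?_
  rw [hK]; push_cast; ring

/-- **THE FENCED SQUARE-LEVEL LAW SLOT FOR EVERY `K` — the shape of the junction letter `hL` of ★ `F0P3cDyRamTierZeroRowsTwoThreeOfLevels.pieceRowsWild_gselStar_three_of_fencedLaw_of_hside`**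
at `lb := mstarOfRecord` (for ANY `lb`), (NI2) discharged by ★ `normIndexTwo`: the fenced labelled binder (sq-KSS²) ⟹ the fenced law slot.  So `stub_law_sq` (directive draft v1 §2) = THIS
applied to the (sq-KSS²) census theorem of step (S2); nothing is claimed about (sq-KSS²) here. [cite: Rogawski1990, §4.9 Prop. 4.9.1 (a) p. 55] [cite: LanglandsShelstad1987, §1.3] -/
theorem fencedSqKappaSignSlot_of_labelledModelSum (shift : ℕ → ℕ → ℤ) (Ω : OmegaSchedule) (N₀ lb : ℕ → ℕ) (A : ℕ → ℕ → ℕ → ℕ → ℤ → ℚ)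
    (hSKSS : ∀ {K : Type} [Field K] [Valued K ℤᵐ⁰] [CompleteSpace K] [Fintype 𝓀[K]] (σ : K →+* K) (ϖ : K) (d t : ℕ),
      Valued.v (2 : K) < 1 → IsRamifiedQuadraticDatum σ ϖ d t →
      ∀ c : K, σ c = c → Valued.v c = 1 → (∀ x : K, σ x = x → x ≠ 0 → (∃ z : K, z * σ z = x) ∨ ∃ z : K, z * σ z = c * x) →
      ∀ (δ : K), σ δ = -δ → δ ≠ 0 →
      ∀ (a b : K), a * σ a = 1 → b * σ b = 1 → Valued.v (a - 1) < Valued.v (2 : K) → Valued.v (b - 1) < Valued.v (2 : K) →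
      ∀ (n₁ n₂ n₃ : ℕ), IsElementDatum σ ϖ (N₀ d) (a * a) (b * b) n₁ n₂ n₃ →
      ∀ (T : GL (Fin 3) K), (T : Matrix (Fin 3) (Fin 3) K) = Matrix.diagonal ![a * a, b * b, 1] →
      ∀ (k : ℕ), 2 * k + d = n₁ + n₂ + n₃ + 2 →
      ∀ (i : Fin 3) (B : ℤ), 2 * B = ((![n₁, n₂, n₃] : Fin 3 → ℕ) i : ℤ) - d + 2 - 2 * shift d t →
        ((∑ s : Fin 3 → Bool,
            (![(if s 1 then -1 else 1) * (if s 2 then -1 else 1),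
               (if s 0 then -1 else 1) * (if s 2 then -1 else 1),
               (if s 0 then -1 else 1) * (if s 1 then -1 else 1)] : Fin 3 → ℤ) i *
              ({M : Submodule 𝒪[K] (Fin 3 → K) |
                IsVertexLattice σ ϖ (Matrix.diagonal fun j => if s j then c else (1 : K)) 0 M ∧ mapGL T M = M ∧
                  LatticeInLevel ϖ (lb d) (Matrix.diagonal ![(a * a - 1) * (a * a - 1), (b * b - 1) * (b * b - 1), 0]) M}.ncard : ℤ) : ℤ) : ℚ) =
          2 * ((Ω K σ ϖ d a b i * ((![normSign σ (-1 : K), normSign σ (-1 : K), 1] : Fin 3 → ℤ) i *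
            (baseSign σ i * normSign σ (fPartProd δ ![a, b, 1] i))) : ℤ) : ℚ) * A (Fintype.card 𝓀[K]) d t k B)
    {K : Type} [Field K] [Valued K ℤᵐ⁰] [CompleteSpace K] [Fintype 𝓀[K]] (σ : K →+* K) (ϖ : K) (d t : ℕ) :
    Valued.v (2 : K) < 1 → IsRamifiedQuadraticDatum σ ϖ d t →
      ∀ (f : Fin 4 → Fin 3 → (Fin 3 → K)), IsFourFrameFamily σ f →
      ∀ (δ : K), σ δ = -δ → δ ≠ 0 →
      ∀ (a b : K), a * σ a = 1 → b * σ b = 1 → Valued.v (a - 1) < Valued.v (2 : K) → Valued.v (b - 1) < Valued.v (2 : K) →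
      ∀ (n₁ n₂ n₃ : ℕ), IsElementDatum σ ϖ (N₀ d) (a * a) (b * b) n₁ n₂ n₃ →
      ∀ (Γ : Fin 4 → GL (Fin 3) K), (∀ b', (Γ b' : Matrix (Fin 3) (Fin 3) K) = frameElt σ f b' (a * a) (b * b)) →
      ∀ (k : ℕ), 2 * k + d = n₁ + n₂ + n₃ + 2 →
      ∀ (i : Fin 3) (B : ℤ), 2 * B = ((![n₁, n₂, n₃] : Fin 3 → ℕ) i : ℤ) - d + 2 - 2 * shift d t →
        ((∑ b' : Fin 4, kappaChar i b' * ({M : Submodule (Valued.integer K) (Fin 3 → K) | IsVertexLattice σ ϖ ((StdForm.antidiagonal 3).over K) 0 M ∧ mapGL (Γ b') M = M ∧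
            LatticeInLevel ϖ (lb d) (((Γ b' : Matrix (Fin 3) (Fin 3) K) - 1) * ((Γ b' : Matrix (Fin 3) (Fin 3) K) - 1)) M}.ncard : ℤ) : ℤ) : ℚ) =
          (Ω K σ ϖ d a b i * (baseSign σ i * normSign σ (fPartProd δ ![a, b, 1] i)) : ℤ) * A (Fintype.card 𝓀[K]) d t k B := by
  intro h2 hD
  exact sqKappaSignClause_of_normIndexTwo_of_labelledModelSum shift Ω N₀ lb A σ ϖ d t (normIndexTwo σ ϖ d t hD)
    (fun c hσc hvc hdich => hSKSS σ ϖ d t h2 hD c hσc hvc hdich) hD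

end Square

end Summit.HodgeConjecture.HodgeConjecture.Cruxes.H413.F0P3cDyRamLevelsKappaSignLawOfLabelledModelSum

end
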